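import Summits.CriticalPhenomena.Ising3DConformalLimit.Theses.MonotoneBlocking
import Summits.CriticalPhenomena.Ising3DConformalLimit.Theses.HyperoctahedralRP
import Summits.CriticalPhenomena.Ising3DConformalLimit.Theorems.HyperoctahedralRPLimitRotationInvariant
import Summits.CriticalPhenomena.Ising3DConformalLimit.Theorems.HyperoctahedralRPHRP2Rigidity
import Literature.Probability.LatticeModels.CriticalScalingDimension

/-!
# Vetting certificate for crux `LimitsAreConformal` (item stmt-CriticalPhenomena-6154)

`S → C` probe, positive: the summit conjunct `Ising3DConformalLimit` IMPLIES the crux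
`MonotoneBlocking.LimitsAreConformal` (shared verbatim with `MirrorHoelderCompactness.LimitsAreConformal`).
Mechanism: pointwise scaling limits of one lattice family along the full filter `𝓝[>] 0` with
non-degenerate two-point functions are unique up to the constant `c^n`, `c = lim ρ/ρ₀ > 0`
(`limits_proportional`); the normalisation `S = 0` off `NonCoincident` then transports rotation
invariance, inversion covariance (with `Δ = Δ₀` forced by scale covariance + non-degeneracy) and
`U₄ ≢ 0` from the summit's witness to every limit in the crux's scope.

Consequence for the refuter: the crux is a NECESSARY condition of the summit conjunct — any `¬ LimitsAreConformal`
would be `¬ Ising3DConformalLimit`. Refuter evidence only (positive statement; a prover may land it).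
-/

open Filter Topology
open Literature.Probability.LatticeModels

namespace Summit.CriticalPhenomena.Ising3DConformalLimit.Cruxes.LimitsAreConformal.Vetting

theorem injective_vec2 {α : Type*} {a b : α} (h : a ≠ b) : Function.Injective ![a, b] := by
  intro i j hij
  fin_cases i <;> fin_cases j <;> simp_all

/-- Eventually along `𝓝[>] 0` the mesh lies in `(0,1]`. -/
theorem eventually_mem_Ioc : ∀ᶠ δ in 𝓝[>] (0:ℝ), δ ∈ Set.Ioc (0:ℝ) 1 := by
  have h1 : ∀ᶠ δ in 𝓝[>] (0:ℝ), δ ∈ Set.Ioi (0:ℝ) := self_mem_nhdsWithin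
  have h2 : ∀ᶠ δ in 𝓝[>] (0:ℝ), δ ∈ Set.Iic (1:ℝ) :=
    mem_nhdsWithin_of_mem_nhds (Iic_mem_nhds one_pos)
  filter_upwards [h1, h2] with δ h1 h2 using ⟨h1, h2⟩

/-- **Uniqueness of pointwise scaling limits up to a constant.** Two renormalised full-filter limits of the same
lattice family with non-degenerate two-point functions differ by `c^n`, `c > 0`, on non-coincident configurations. -/
theorem limits_proportional {G : LatticeCorrFamily 3} {ρ ρ₀ : ℝ → ℝ} {S S₀ : CorrFamily 3}
    (hρ : ∀ δ ∈ Set.Ioc (0:ℝ) 1, 0 < ρ δ) (hρ₀ : ∀ δ ∈ Set.Ioc (0:ℝ) 1, 0 < ρ₀ δ)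
    (hlim : HasPointwiseScalingLimit G ρ S) (hlim₀ : HasPointwiseScalingLimit G ρ₀ S₀)
    (hnd : IsNondegenerateTwoPoint S) (hnd₀ : IsNondegenerateTwoPoint S₀)
    {xs : Fin 2 → EuclideanSpace ℝ (Fin 3)} (hxs : xs ∈ NonCoincident 3 2) :
    ∃ c : ℝ, 0 < c ∧ ∀ n, ∀ x ∈ NonCoincident 3 n, S n x = c ^ n * S₀ n x := by
  have hev := eventually_mem_Ioc
  have ha : 0 < S 2 xs := hnd xs hxs
  have ha₀ : 0 < S₀ 2 xs := hnd₀ xs hxs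
  have hT : Tendsto (fun δ => rescaledCorrelator G ρ 2 δ xs) (𝓝[>] 0) (𝓝 (S 2 xs)) :=
    (hlim 2).tendsto_at hxs
  have hT₀ : Tendsto (fun δ => rescaledCorrelator G ρ₀ 2 δ xs) (𝓝[>] 0) (𝓝 (S₀ 2 xs)) :=
    (hlim₀ 2).tendsto_at hxs
  have hT₀pos : ∀ᶠ δ in 𝓝[>] (0:ℝ), S₀ 2 xs / 2 < rescaledCorrelator G ρ₀ 2 δ xs :=
    hT₀.eventually (lt_mem_nhds (by linarith))
  -- the squared ratio of renormalisations converges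
  have hR2 : Tendsto (fun δ => (ρ δ / ρ₀ δ) ^ 2) (𝓝[>] 0) (𝓝 (S 2 xs / S₀ 2 xs)) := by
    have hdiv := hT.div hT₀ ha₀.ne'
    refine hdiv.congr' ?_
    filter_upwards [hev, hT₀pos] with δ hδ hpos
    have hρ₀δ : ρ₀ δ ≠ 0 := (hρ₀ δ hδ).ne'
    have hG : G 2 (fun i => latticeApprox δ (xs i)) ≠ 0 := by
      intro hG
      simp only [rescaledCorrelator, hG, mul_zero] at hpos
      linarith
    simp only [Pi.div_apply, rescaledCorrelator]
    field_simp
  have hL : 0 < S 2 xs / S₀ 2 xs := div_pos ha ha₀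
  have hR : Tendsto (fun δ => ρ δ / ρ₀ δ) (𝓝[>] 0) (𝓝 (Real.sqrt (S 2 xs / S₀ 2 xs))) := by
    refine hR2.sqrt.congr' ?_
    filter_upwards [hev] with δ hδ
    exact Real.sqrt_sq (div_pos (hρ δ hδ) (hρ₀ δ hδ)).le
  refine ⟨Real.sqrt (S 2 xs / S₀ 2 xs), Real.sqrt_pos.2 hL, fun n x hx => ?_⟩
  have h1 : Tendsto (fun δ => rescaledCorrelator G ρ n δ x) (𝓝[>] 0) (𝓝 (S n x)) :=
    (hlim n).tendsto_at hx
  have h2 : Tendsto (fun δ => rescaledCorrelator G ρ n δ x) (𝓝[>] 0)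
      (𝓝 (Real.sqrt (S 2 xs / S₀ 2 xs) ^ n * S₀ n x)) := by
    have := (hR.pow n).mul ((hlim₀ n).tendsto_at hx)
    refine this.congr' ?_
    filter_upwards [hev] with δ hδ
    have hρ₀δ : ρ₀ δ ≠ 0 := (hρ₀ δ hδ).ne'
    simp only [rescaledCorrelator, div_pow]
    field_simp
  exact tendsto_nhds_unique h1 h2

/-- **`S → C`: the summit conjunct implies the crux.** -/
theorem limitsAreConformal_of_summit (h : _root_.Ising3DConformalLimit) :
    Summit.CriticalPhenomena.Ising3DConformalLimit.Theses.MonotoneBlocking.LimitsAreConformal := by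
  obtain ⟨ρ₀, Δ₀, S₀, hρ₀, -, hlim₀, hnd₀, hM, hU4₀⟩ := h
  intro ρ Δ S hρ hlim hnorm hnd _htr hsc
  obtain ⟨x4, hx4, hU⟩ := hU4₀
  have hx4i : Function.Injective x4 := hx4
  -- a non-coincident pair
  set xs : Fin 2 → EuclideanSpace ℝ (Fin 3) := ![x4 0, x4 1] with hxs_def
  have hxs : xs ∈ NonCoincident 3 2 := injective_vec2 (hx4i.ne (by decide))
  obtain ⟨c, hc, hprop⟩ := limits_proportional hρ hρ₀ hlim hlim₀ hnd hnd₀ hxs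
  have hcn : ∀ n, c ^ n ≠ 0 := fun n => pow_ne_zero n hc.ne'
  -- Δ is forced
  have hΔ : Δ = Δ₀ := by
    have hsc₀ : IsScaleCovariant Δ₀ S₀ := hM.2.1
    have h2xs : (fun i => (2:ℝ) • xs i) ∈ NonCoincident 3 2 :=
      (smul_right_injective (EuclideanSpace ℝ (Fin 3)) (two_ne_zero' ℝ)).comp hxs
    have e1 := hsc 2 2 two_pos xs
    have e2 := hsc₀ 2 2 two_pos xs
    rw [hprop 2 _ h2xs, hprop 2 _ hxs, e2] at e1
    -- e1 : c^2 * (2^(-2Δ₀) * S₀ 2 xs) = 2^(-2Δ) * (c^2 * S₀ 2 xs)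
    have hpos : 0 < S₀ 2 xs := hnd₀ xs hxs
    have e3 : (2:ℝ) ^ (-((2:ℕ):ℝ) * Δ₀) = (2:ℝ) ^ (-((2:ℕ):ℝ) * Δ) := by
      have := mul_right_cancel₀ (mul_ne_zero (hcn 2) hpos.ne') (show
        (2:ℝ) ^ (-((2:ℕ):ℝ) * Δ₀) * (c ^ 2 * S₀ 2 xs) = (2:ℝ) ^ (-((2:ℕ):ℝ) * Δ) * (c ^ 2 * S₀ 2 xs) by
          rw [← e1]; ring)
      exact this
    have e4 := (Real.rpow_right_inj (by norm_num : (0:ℝ) < 2) (by norm_num : (2:ℝ) ≠ 1)).1 e3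
    push_cast at e4
    linarith
  subst hΔ
  refine ⟨?_, ?_, ?_⟩
  · -- rotation invariance
    intro n R x
    by_cases hx : Function.Injective x
    · have hRx : Function.Injective (fun i => R (x i)) := R.injective.comp hx
      rw [hprop n _ hRx, hprop n _ hx, hM.1.2 n R x]
    · have hRx : ¬ Function.Injective (fun i => R (x i)) := fun h' =>
        hx (Function.Injective.of_comp (f := R) h')
      rw [hnorm n _ hRx, hnorm n _ hx]
  · -- inversion covariance
    intro n x hx0
    by_cases hx : Function.Injective x
    · have hIx : Function.Injective (fun i => EuclideanGeometry.inversion 0 1 (x i)) :=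
        (EuclideanGeometry.inversion_injective (0 : EuclideanSpace ℝ (Fin 3)) one_ne_zero).comp hx
      rw [hprop n _ hIx, hprop n _ hx, hM.2.2 n x hx0]
      ring
    · have hIx : ¬ Function.Injective (fun i => EuclideanGeometry.inversion 0 1 (x i)) := fun h' =>
        hx (Function.Injective.of_comp (f := EuclideanGeometry.inversion 0 1) h')
      rw [hnorm n _ hIx, hnorm n _ hx, mul_zero]
  · -- non-trivial U₄
    refine ⟨x4, hx4, ?_⟩
    have hp : ∀ i j : Fin 4, i ≠ j → S 2 ![x4 i, x4 j] = c ^ 2 * S₀ 2 ![x4 i, x4 j] :=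
      fun i j hij => hprop 2 _ (injective_vec2 (hx4i.ne hij))
    have h4 : S 4 x4 = c ^ 4 * S₀ 4 x4 := hprop 4 _ hx4
    have key : limitConnectedFour S x4 = c ^ 4 * limitConnectedFour S₀ x4 := by
      simp only [limitConnectedFour]
      rw [h4, hp 0 1 (by decide), hp 2 3 (by decide), hp 0 2 (by decide), hp 1 3 (by decide),
        hp 0 3 (by decide), hp 1 2 (by decide)]
      ring
    rw [key]
    exact mul_ne_zero (hcn 4) hU

/-- Conjunct (i) of the crux is CLOSED in the tree: rotation invariance of every limit in the crux's scope is the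
composition of the landed `HRP2Rigidity_of` (item 1979) and `limitRotationInvariant_proof` (item 1980). -/
theorem rotation_conjunct_closed (ρ : ℝ → ℝ) (Δ : ℝ) (S : CorrFamily 3)
    (hρ : ∀ δ ∈ Set.Ioc (0:ℝ) 1, 0 < ρ δ) (hlim : HasPointwiseScalingLimit (criticalCorr 3) ρ S)
    (hnorm : ∀ n z, z ∉ NonCoincident 3 n → S n z = 0) (hnd : IsNondegenerateTwoPoint S)
    (htr : IsTranslationInvariant S) (hsc : IsScaleCovariant Δ S) : IsRotationInvariant S :=
  Summit.CriticalPhenomena.Ising3DConformalLimit.Cruxes.LimitRotationInvariant.QuarterTurnLiouville.limitRotationInvariant_proof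
    Summit.CriticalPhenomena.Ising3DConformalLimit.Cruxes.HRP2Rigidity.XRayMellin.HRP2Rigidity_of
    ρ Δ S hρ hlim hnorm hnd htr hsc

/-- Hence the crux REDUCES to its conjuncts (ii) ∧ (iii). -/
theorem limitsAreConformal_iff_reduced :
    Summit.CriticalPhenomena.Ising3DConformalLimit.Theses.MonotoneBlocking.LimitsAreConformal ↔
    ∀ (ρ : ℝ → ℝ) (Δ : ℝ) (S : CorrFamily 3), (∀ δ ∈ Set.Ioc (0:ℝ) 1, 0 < ρ δ) →
      HasPointwiseScalingLimit (criticalCorr 3) ρ S → (∀ n z, z ∉ NonCoincident 3 n → S n z = 0) →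
      IsNondegenerateTwoPoint S → IsTranslationInvariant S → IsScaleCovariant Δ S →
      IsInversionCovariant Δ S ∧ HasNontrivialU4 S := by
  constructor
  · intro h ρ Δ S hρ hlim hnorm hnd htr hsc
    exact (h ρ Δ S hρ hlim hnorm hnd htr hsc).2
  · intro h ρ Δ S hρ hlim hnorm hnd htr hsc
    exact ⟨rotation_conjunct_closed ρ Δ S hρ hlim hnorm hnd htr hsc, h ρ Δ S hρ hlim hnorm hnd htr hsc⟩

/-- **The crux is EXACTLY "existence ⟹ summit".** `LimitsAreConformal ↔ (ExistsScaleCovariantLimit → Ising3DConformalLimit)`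
(`ExistsScaleCovariantLimit` = item stmt-CriticalPhenomena-1981, the conclusion of this route's `BlockingGivesLimit`;
`0 < Δ` is supplied by the tree fact `scalingDimension_mem_Icc_holds`, `1/2 ≤ Δ ≤ 1`). -/
theorem limitsAreConformal_iff_exists_imp_summit :
    Summit.CriticalPhenomena.Ising3DConformalLimit.Theses.MonotoneBlocking.LimitsAreConformal ↔
    (Summit.CriticalPhenomena.Ising3DConformalLimit.Theses.HyperoctahedralRP.ExistsScaleCovariantLimit →
      _root_.Ising3DConformalLimit) := by
  constructor
  · intro hLAC ⟨ρ, Δ, S, hρ, hΔ, hlim, hnorm, hnd, htr, hsc⟩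
    obtain ⟨hrot, hinv, hU4⟩ := hLAC ρ Δ S hρ hlim hnorm hnd htr hsc
    exact ⟨ρ, Δ, S, hρ, hΔ, hlim, hnd, ⟨⟨htr, hrot⟩, hsc, hinv⟩, hU4⟩
  · intro h ρ Δ S hρ hlim hnorm hnd htr hsc
    have hΔ : 0 < Δ := by
      have := (scalingDimension_mem_Icc_holds ρ Δ S hlim hsc hnd hρ).1
      linarith
    exact limitsAreConformal_of_summit (h ⟨ρ, Δ, S, hρ, hΔ, hlim, hnorm, hnd, htr, hsc⟩)
      ρ Δ S hρ hlim hnorm hnd htr hsc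

#print axioms limitsAreConformal_of_summit
#print axioms limitsAreConformal_iff_exists_imp_summit

end Summit.CriticalPhenomena.Ising3DConformalLimit.Cruxes.LimitsAreConformal.Vetting
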